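import Summits.QuantumFields.BalabanUV.Beta.FP.PerfectBiStencilStep
import Summits.QuantumFields.BalabanUV.Beta.GAN24.T2UnitSplitShapes
import Summits.QuantumFields.BalabanUV.Beta.RecursiveWSlot

/-!
# `BalabanUV.Beta.GAN24.T2RecOfUnitSplit` — binder row G-an2-4 ∕ (CONV-C), **CT-W (F1)**: THE AFFINE SPLIT AND THE n-LEVEL UNROLLING OF THE NORMALISED RECURSION OF
# an2's SLOTTED SECOND-ORDER TABLES `RecursiveWSlot.T2RecOf G S M cE₂ cB T vh₂S mixFF` — GENERIC RESOLVENT SLOT `G` (comb family `T2RecAt ρ` by `RecursiveWSlot.T2RecOf_comb`;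
# road FP's symmetric family at `G := Gsym Lc`) = the (F1) rows `hsplit` of road W3's carrier-free ENDs `WSlotT2OfPieces.shape_of_rows` ∕ `rate_of_rows` for the DRESSED tower
NOT IN PRINT; OUR BOOKKEEPING (road-P2 chair of row G-an2-4, unit `b2b-balaban-gan24-p2` gen 35, crux team (2); journal INTENT «CT-W SCOPING» [GAN24P2-G35-INTENT1], memo
`HOME/b2b-balaban-gan24-p2/gen35/CT-W-SCOPE-v0.md` §2 (F1)).  HONEST FRAMING (cell contract, verbatim): «discharging `BetaPertH` makes Bałaban's UV stability UNCONDITIONAL — a real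
constructive-QFT result; it is NOT the continuum limit and NOT the Clay problem.»  HONEST DEPENDENCY (verbatim): «continuum YM on T⁴ ⇐ BetaPertH ∧ nine spine estimates (0/9
proved); BetaPertH ⇐ (D1) ∧ (D4) ∧ CAP+tail; G-an2-4 gates asym, D1 and NE2/3/4.»  [folklore] kernel algebra BY NAME (0 `def`, 0 cited facts, 0 `def … : Prop`, 0 sorry):
d1-formalise-leaf-02 g13's rescaled step `FP/PerfectBiStencilStep.unitS₂_T2RecOf_succ`, leaf-04's generic `T2RecursionAffine.W2SymOfK_eq_add_vsym` ∕ `K3OfK_eq_sub_of_W` ∕ `lin4`,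
leaf-01's `AffineUnroll.eq_transport_add_sum` ∕ `diff_eq_transport_add_sum` + `Lin4Additive` + the class lemmas of `T2UnitSplitLevels` ∕ `T2UnitSplitShapes`, an2's `RecursiveWSlot`
letters — proofs = the `T2Of` modules VERBATIM with `K♮_j ↦ unitK_j (G j)`: §1 **`unitS₂_T2RecOf_succ_affine`**, **`unitS₂_T2RecOf_succ_eq_lin4_add`**; §2 **`unitS₂_T2RecOf_eq_transport_add_sum`**
(`T̃_n = 𝒯 0 n T̃_0 + Σ_{i<n} 𝒯 (i+1) (n−1−i) b̃_i`, `𝒯 = transport (j ↦ lin4 (cE₂·Lc^{2(d+1)}) G̃_j Lc)`), **`unitS₂_T2RecOf_sub_eq_transport_add_sum`** (difference tower, shifted transport);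
§3 **`step_data_of_letters`**, **`bdd₄_unitS₂_T2RecOf_of_letters`**, **`unitS₂_T2RecOf_eq_transport_add_sum_of_letters`** (every per-level datum from an2's letters (DG)(LS)(LM) + `hB` + `hmix`;
(ShB₂) on `vh₂S` displayed).  Discharges NOTHING of «T2Shape» ∕ «T2Drift» ∕ (hW, hWall): road W3's rows (F2)–(F4) for the dressed tower are OPEN (CT-W).  NEVER «G-an2-4 closed» as
(CONV-C); NOT D1, NOT `BetaPertH`, NOT continuum, NOT Clay; not in print — our bookkeeping.  Unit `b2b-balaban-gan24-p2` (gen 35), 2026-08-21.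
-/

noncomputable section

open Finset
open scoped BigOperators
open Literature.MathematicalPhysics.QuantumFieldTheory
open Literature.MathematicalPhysics.QuantumFieldTheory.Balaban1983to89
open Literature.MathematicalPhysics.QuantumFieldTheory.Balaban1983to89.Beta
open B12Sec2to5 (l1 l1_nonneg)
open ExpKernelCalculus (MKer Decays BiLoc VertexFamily VertexFamily₂)
open OneStepResolventKernel (Fib LocStencil decays_mono)
open SecondOrderResponse (W2SymOfK LocStencilFM vertexFamily₂_W2SymOfK')
open BalabanCompositeJets (LocStencil₂)
open BalabanStepJetsSucc (mmRead)
open BalabanStepW2 (K3OfK M2Of locStencilFM_M2Of)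
open BalabanStepJets (vertexFamily₂_mono)
open Summit.QuantumFields.BalabanUV.Beta.HessKerDressedUnits (unitK unitS unitW decays_unitK vertexFamily₂_unitW)
open Summit.QuantumFields.BalabanUV.Beta.SecondOrderUnits (unitM unitS₂ unitM₂ unitW_W2SymOfK)
open Summit.QuantumFields.BalabanUV.Beta.SpineRooted (e4OfKW T2RecOf WrecOf WrecOf_eq T2RecOf_loc vertexFamily₂_WrecOf')
open Summit.QuantumFields.BalabanUV.Beta.GAN24.CombesThomas (sfStep smStep sfStep_ne_zero smStep_ne_zero)
open Summit.QuantumFields.BalabanUV.Beta.GAN24.ThirdJetKernel (mmRead_sub)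
open Summit.QuantumFields.BalabanUV.Beta.GAN24.T2RecursionAffine (lin4 lin4_apply vsym W2SymOfK_eq_add_vsym K3OfK_eq_sub_of_W)
open Summit.QuantumFields.BalabanUV.Beta.GAN24.AffineUnroll (transport eq_transport_add_sum diff_eq_transport_add_sum)
open Summit.QuantumFields.BalabanUV.Beta.GAN24.Lin4Additive (lin4_bdd lin4_add)
open Summit.QuantumFields.BalabanUV.Beta.GAN24.T2UnitSplitLevels (bdd₄_zero bdd₄_add bdd₄_sub lin4_add_of_bdd₄)
open Summit.QuantumFields.BalabanUV.Beta.GAN24.T2UnitSplitShapes (bdd₄_unitS₂ bdd₄_of_locStencil₂)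
open Summit.QuantumFields.BalabanUV.Beta.GAN24.T2SlotUnits (unitS₂_apply)
open Summit.QuantumFields.BalabanUV.Beta.FP.PerfectBiStencilStep (unitS₂_T2RecOf_succ)

namespace Summit.QuantumFields.BalabanUV.Beta.GAN24.T2RecOfUnitSplit

variable {d : ℕ}

/-! ## §1 The affine step of the slotted family, generic resolvent slot -/
section Generic
variable {Lc : ℕ} [NeZero Lc] (G : ℕ → MKer (d + 1) (Fib d)) (S M : ℕ → Fin (d + 1) → (Fin (d + 1) → ℤ) → MKer (d + 1) (Fib d)) (cE₂ cB : ℝ)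
  (Tc : Fin 4 → Fin 4 → Fin 4 → Fin 4 → ℝ)
  (vh₂S mixFF : Fin (d + 1) → (Fin (d + 1) → ℤ) → Fin (d + 1) → (Fin (d + 1) → ℤ) → MKer (d + 1) (Fib d))

/-- [folklore] **(U-T2, SLOTTED) THE NORMALISED RECURSION OF `T2RecOf G S M …` IS AFFINE IN THE PREVIOUS MEMBER** — generic resolvent slot.  In the adopted
units, with `G̃_j = unitK_j (G j)`, `S̃_j = unitS_j (S j)`, `M̃_j = unitM_j (M j)`, `M̃₂_j = unitM₂_j (M2Of mixFF j)`, `T̃_j = unitS₂_j (T2RecOf … j)`, for an off-diagonal-valued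
border `vh₂S` ((ShB₂): `hBff`, `hBmm`), a decaying `G̃_j` (rate `δ > 0`) and the normalised second-order member `W2SymOfK G̃_j Lc S̃_j M̃_j T̃_j M̃₂_j` together with its
`T̃_j`-free part bi-localised at rate `δ`:
`T̃_{j+1} = [ (cE₂·Lc^{2(d+1)}) • mmRead Lc ∘ K3OfK G̃_j Lc S̃_j M̃_j (W2SymOfK G̃_j Lc S̃_j M̃_j 0 M̃₂_j) + cB • vh₂S ] + lin4 (cE₂·Lc^{2(d+1)}) G̃_j Lc T̃_j`
— d1-formalise-leaf-02's `PerfectBiStencilStep.unitS₂_T2RecOf_succ` split by leaf-04's `W2SymOfK_eq_add_vsym` ∕ `K3OfK_eq_sub_of_W` (proof = `T2RecursionAffine.unitS₂_T2Of_succ_affine`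
verbatim with `K♮_j ↦ G̃_j`). -/
theorem unitS₂_T2RecOf_succ_affine
    (hBff : ∀ κ u κ' u' x z (α β : Fin (d + 1)), vh₂S κ u κ' u' x z (Sum.inl α) (Sum.inl β) = 0)
    (hBmm : ∀ κ u κ' u' x z (μ ν : Fin (d + 1)), vh₂S κ u κ' u' x z (Sum.inr μ) (Sum.inr ν) = 0) (j : ℕ) {C δ C₀ C₁ : ℝ} (hδ : 0 < δ)
    (hK : Decays (unitK (sfStep Lc j) (smStep d Lc j) (G j)) C δ)
    (h₀ : VertexFamily₂ (W2SymOfK (unitK (sfStep Lc j) (smStep d Lc j) (G j)) Lc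
      (unitS (sfStep Lc j) (smStep d Lc j) (S j)) (unitM (sfStep Lc j) (smStep d Lc j) (M j)) 0
      (unitM₂ (sfStep Lc j) (smStep d Lc j) (M2Of d Lc mixFF j))) Lc C₀ δ)
    (hWj : VertexFamily₂ (W2SymOfK (unitK (sfStep Lc j) (smStep d Lc j) (G j)) Lc
      (unitS (sfStep Lc j) (smStep d Lc j) (S j)) (unitM (sfStep Lc j) (smStep d Lc j) (M j))
      (unitS₂ (sfStep Lc j) (smStep d Lc j) (T2RecOf d Lc G S M cE₂ cB Tc vh₂S mixFF j))
      (unitM₂ (sfStep Lc j) (smStep d Lc j) (M2Of d Lc mixFF j))) Lc C₁ δ) :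
    unitS₂ (sfStep Lc (j + 1)) (smStep d Lc (j + 1)) (T2RecOf d Lc G S M cE₂ cB Tc vh₂S mixFF (j + 1)) = fun κ u κ' u' =>
      ((cE₂ * (Lc : ℝ) ^ (2 * (d + 1))) •
          mmRead Lc (K3OfK (unitK (sfStep Lc j) (smStep d Lc j) (G j)) Lc
            (unitS (sfStep Lc j) (smStep d Lc j) (S j)) (unitM (sfStep Lc j) (smStep d Lc j) (M j))
            (W2SymOfK (unitK (sfStep Lc j) (smStep d Lc j) (G j)) Lc
              (unitS (sfStep Lc j) (smStep d Lc j) (S j)) (unitM (sfStep Lc j) (smStep d Lc j) (M j)) 0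
              (unitM₂ (sfStep Lc j) (smStep d Lc j) (M2Of d Lc mixFF j))) κ u κ' u')
        + cB • vh₂S κ u κ' u')
      + lin4 (cE₂ * (Lc : ℝ) ^ (2 * (d + 1))) (unitK (sfStep Lc j) (smStep d Lc j) (G j)) Lc
          (unitS₂ (sfStep Lc j) (smStep d Lc j) (T2RecOf d Lc G S M cE₂ cB Tc vh₂S mixFF j)) κ u κ' u' := by
  rw [unitS₂_T2RecOf_succ G S M cE₂ cB Tc vh₂S mixFF hBff hBmm j]
  funext κ u κ' u'
  simp only [e4OfKW]
  have hvs : W2SymOfK (unitK (sfStep Lc j) (smStep d Lc j) (G j)) Lc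
        (unitS (sfStep Lc j) (smStep d Lc j) (S j)) (unitM (sfStep Lc j) (smStep d Lc j) (M j))
        (unitS₂ (sfStep Lc j) (smStep d Lc j) (T2RecOf d Lc G S M cE₂ cB Tc vh₂S mixFF j))
        (unitM₂ (sfStep Lc j) (smStep d Lc j) (M2Of d Lc mixFF j)) κ u κ' u' -
      W2SymOfK (unitK (sfStep Lc j) (smStep d Lc j) (G j)) Lc
        (unitS (sfStep Lc j) (smStep d Lc j) (S j)) (unitM (sfStep Lc j) (smStep d Lc j) (M j)) 0
        (unitM₂ (sfStep Lc j) (smStep d Lc j) (M2Of d Lc mixFF j)) κ u κ' u' =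
      vsym (unitK (sfStep Lc j) (smStep d Lc j) (G j)) Lc
        (unitS₂ (sfStep Lc j) (smStep d Lc j) (T2RecOf d Lc G S M cE₂ cB Tc vh₂S mixFF j)) κ u κ' u' := by
    rw [W2SymOfK_eq_add_vsym (unitK (sfStep Lc j) (smStep d Lc j) (G j)) Lc
      (unitS (sfStep Lc j) (smStep d Lc j) (S j)) (unitM (sfStep Lc j) (smStep d Lc j) (M j))
      (unitS₂ (sfStep Lc j) (smStep d Lc j) (T2RecOf d Lc G S M cE₂ cB Tc vh₂S mixFF j))]
    simp only [Pi.add_apply, add_sub_cancel_left]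
  rw [K3OfK_eq_sub_of_W hK hδ Lc _ _ (hWj κ u κ' u') (h₀ κ u κ' u'), hvs, mmRead_sub, smul_sub, lin4_apply]
  abel

/-- [folklore] **THE AFFINE STEP IN `Pi` FORM**: `T̃_{j+1} = 𝒜_j T̃_j + b̃_j` with `𝒜_j = lin4 (cE₂·Lc^{2(d+1)}) G̃_j Lc` (summands commuted; twin of leaf-01's
`T2UnitSplitLevels.unitS₂_T2Of_succ_eq_lin4_add`). -/
theorem unitS₂_T2RecOf_succ_eq_lin4_add
    (hBff : ∀ κ u κ' u' x z (α β : Fin (d + 1)), vh₂S κ u κ' u' x z (Sum.inl α) (Sum.inl β) = 0)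
    (hBmm : ∀ κ u κ' u' x z (μ ν : Fin (d + 1)), vh₂S κ u κ' u' x z (Sum.inr μ) (Sum.inr ν) = 0) (j : ℕ) {C δ C₀ C₁ : ℝ} (hδ : 0 < δ)
    (hK : Decays (unitK (sfStep Lc j) (smStep d Lc j) (G j)) C δ) (h₀ : VertexFamily₂ (W2SymOfK
          (unitK (sfStep Lc j) (smStep d Lc j) (G j)) Lc (unitS (sfStep Lc j) (smStep d Lc j) (S j))
          (unitM (sfStep Lc j) (smStep d Lc j) (M j)) 0 (unitM₂ (sfStep Lc j) (smStep d Lc j) (M2Of d Lc mixFF j))) Lc C₀ δ)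
    (hW : VertexFamily₂ (W2SymOfK (unitK (sfStep Lc j) (smStep d Lc j) (G j)) Lc
          (unitS (sfStep Lc j) (smStep d Lc j) (S j)) (unitM (sfStep Lc j) (smStep d Lc j) (M j))
          (unitS₂ (sfStep Lc j) (smStep d Lc j) (T2RecOf d Lc G S M cE₂ cB Tc vh₂S mixFF j))
          (unitM₂ (sfStep Lc j) (smStep d Lc j) (M2Of d Lc mixFF j))) Lc C₁ δ) :
    (unitS₂ (sfStep Lc (j + 1)) (smStep d Lc (j + 1)) (T2RecOf d Lc G S M cE₂ cB Tc vh₂S mixFF (j + 1))) = lin4 (cE₂ * (Lc : ℝ) ^ (2 * (d + 1)))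
          (unitK (sfStep Lc j) (smStep d Lc j) (G j)) Lc (unitS₂ (sfStep Lc j) (smStep d Lc j)
          (T2RecOf d Lc G S M cE₂ cB Tc vh₂S mixFF j)) + (fun κ u κ' u' => (cE₂ * (Lc : ℝ) ^ (2 * (d + 1))) • mmRead Lc (K3OfK
          (unitK (sfStep Lc j) (smStep d Lc j) (G j)) Lc (unitS (sfStep Lc j) (smStep d Lc j) (S j))
          (unitM (sfStep Lc j) (smStep d Lc j) (M j)) (W2SymOfK (unitK (sfStep Lc j) (smStep d Lc j) (G j)) Lc
          (unitS (sfStep Lc j) (smStep d Lc j) (S j)) (unitM (sfStep Lc j) (smStep d Lc j) (M j)) 0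
          (unitM₂ (sfStep Lc j) (smStep d Lc j) (M2Of d Lc mixFF j))) κ u κ' u') + cB • vh₂S κ u κ' u') := by
  rw [unitS₂_T2RecOf_succ_affine G S M cE₂ cB Tc vh₂S mixFF hBff hBmm j hδ hK h₀ hW]
  funext κ u κ' u'
  simp only [Pi.add_apply]
  exact add_comm _ _

/-- [folklore] **(F1) THE LEVEL SUM OF THE NORMALISED T₂ FAMILY** (`hsplit` of the row owner's END #1 `WSlotT2OfPieces.shape_of_rows` with
`P m k := transport (fun j ↦ lin4 c₄ G̃_j Lc) m k` and `b := b̃`), SLOTTED family, generic resolvent: for every `n`,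
`T̃_n = 𝒯 0 n T̃_0 + Σ_{i ∈ range n} 𝒯 (i+1) (n−1−i) b̃_i`.  Hypotheses per level `j` with EXISTENTIAL constants: the step data (`Decays G̃_j C δ`, `δ > 0`, the
`VertexFamily₂` shape at rate `δ` of the normalised second-order member and of its `T̃`-free part) and bounded entries of every `T̃_j`.  Proof: leaf-01's
`AffineUnroll.eq_transport_add_sum` on the class of bounded bi-tables (`Lin4Additive.lin4_add`∕`lin4_bdd`) — `T2UnitSplitLevels.unitS₂_T2Of_eq_transport_add_sum` verbatim with `K♮_j ↦ G̃_j`. -/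
theorem unitS₂_T2RecOf_eq_transport_add_sum
    (hBff : ∀ κ u κ' u' x z (α β : Fin (d + 1)), vh₂S κ u κ' u' x z (Sum.inl α) (Sum.inl β) = 0)
    (hBmm : ∀ κ u κ' u' x z (μ ν : Fin (d + 1)), vh₂S κ u κ' u' x z (Sum.inr μ) (Sum.inr ν) = 0)
    (hdat : ∀ j, ∃ C δ C₀ C₁ : ℝ, 0 < δ ∧ Decays (unitK (sfStep Lc j) (smStep d Lc j) (G j)) C δ ∧ VertexFamily₂ (W2SymOfK
          (unitK (sfStep Lc j) (smStep d Lc j) (G j)) Lc (unitS (sfStep Lc j) (smStep d Lc j) (S j))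
          (unitM (sfStep Lc j) (smStep d Lc j) (M j)) 0 (unitM₂ (sfStep Lc j) (smStep d Lc j) (M2Of d Lc mixFF j))) Lc C₀ δ ∧
      VertexFamily₂ (W2SymOfK (unitK (sfStep Lc j) (smStep d Lc j) (G j)) Lc
            (unitS (sfStep Lc j) (smStep d Lc j) (S j)) (unitM (sfStep Lc j) (smStep d Lc j) (M j))
            (unitS₂ (sfStep Lc j) (smStep d Lc j) (T2RecOf d Lc G S M cE₂ cB Tc vh₂S mixFF j))
            (unitM₂ (sfStep Lc j) (smStep d Lc j) (M2Of d Lc mixFF j))) Lc C₁ δ)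
    (hbdd : ∀ j, ∃ B : ℝ, ∀ κ u κ' u' x z a b, |(unitS₂ (sfStep Lc j) (smStep d Lc j)
          (T2RecOf d Lc G S M cE₂ cB Tc vh₂S mixFF j)) κ u κ' u' x z a b| ≤ B) (n : ℕ) :
    (unitS₂ (sfStep Lc n) (smStep d Lc n) (T2RecOf d Lc G S M cE₂ cB Tc vh₂S mixFF n)) = transport (fun j => lin4 (cE₂ * (Lc : ℝ) ^ (2 * (d + 1)))
          (unitK (sfStep Lc j) (smStep d Lc j) (G j)) Lc) 0 n (unitS₂ (sfStep Lc 0) (smStep d Lc 0)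
          (T2RecOf d Lc G S M cE₂ cB Tc vh₂S mixFF 0)) +
      ∑ i ∈ Finset.range n, transport (fun j => lin4 (cE₂ * (Lc : ℝ) ^ (2 * (d + 1)))
            (unitK (sfStep Lc j) (smStep d Lc j) (G j)) Lc) (i + 1) (n - 1 - i)
            (fun κ u κ' u' => (cE₂ * (Lc : ℝ) ^ (2 * (d + 1))) • mmRead Lc (K3OfK (unitK (sfStep Lc i) (smStep d Lc i) (G i)) Lc
            (unitS (sfStep Lc i) (smStep d Lc i) (S i)) (unitM (sfStep Lc i) (smStep d Lc i) (M i)) (W2SymOfK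
            (unitK (sfStep Lc i) (smStep d Lc i) (G i)) Lc (unitS (sfStep Lc i) (smStep d Lc i) (S i))
            (unitM (sfStep Lc i) (smStep d Lc i) (M i)) 0
            (unitM₂ (sfStep Lc i) (smStep d Lc i) (M2Of d Lc mixFF i))) κ u κ' u') + cB • vh₂S κ u κ' u') := by
  have hrec : ∀ j, (unitS₂ (sfStep Lc (j + 1)) (smStep d Lc (j + 1))
        (T2RecOf d Lc G S M cE₂ cB Tc vh₂S mixFF (j + 1))) = lin4 (cE₂ * (Lc : ℝ) ^ (2 * (d + 1)))
        (unitK (sfStep Lc j) (smStep d Lc j) (G j)) Lc (unitS₂ (sfStep Lc j) (smStep d Lc j)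
        (T2RecOf d Lc G S M cE₂ cB Tc vh₂S mixFF j)) + (fun κ u κ' u' => (cE₂ * (Lc : ℝ) ^ (2 * (d + 1))) • mmRead Lc (K3OfK
        (unitK (sfStep Lc j) (smStep d Lc j) (G j)) Lc (unitS (sfStep Lc j) (smStep d Lc j) (S j))
        (unitM (sfStep Lc j) (smStep d Lc j) (M j)) (W2SymOfK (unitK (sfStep Lc j) (smStep d Lc j) (G j)) Lc
        (unitS (sfStep Lc j) (smStep d Lc j) (S j)) (unitM (sfStep Lc j) (smStep d Lc j) (M j)) 0
        (unitM₂ (sfStep Lc j) (smStep d Lc j) (M2Of d Lc mixFF j))) κ u κ' u') + cB • vh₂S κ u κ' u') := fun j => by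
    obtain ⟨C, δ, C₀, C₁, hδ, hK, h₀, hW⟩ := hdat j
    exact unitS₂_T2RecOf_succ_eq_lin4_add G S M cE₂ cB Tc vh₂S mixFF hBff hBmm j hδ hK h₀ hW
  have hAP : ∀ (j : ℕ) (X : Fin (d + 1) → (Fin (d + 1) → ℤ) → Fin (d + 1) → (Fin (d + 1) → ℤ) → MKer (d + 1) (Fib d)),
      (∃ B : ℝ, ∀ κ u κ' u' x z a b, |X κ u κ' u' x z a b| ≤ B) →
        ∃ B : ℝ, ∀ κ u κ' u' x z a b, |lin4 (cE₂ * (Lc : ℝ) ^ (2 * (d + 1)))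
              (unitK (sfStep Lc j) (smStep d Lc j) (G j)) Lc X κ u κ' u' x z a b| ≤ B := fun j X hX => by
    obtain ⟨C, δ, C₀, C₁, hδ, hK, -, -⟩ := hdat j
    exact lin4_bdd hK hδ _ Lc hX
  have hAadd : ∀ (j : ℕ) (X Y : Fin (d + 1) → (Fin (d + 1) → ℤ) → Fin (d + 1) → (Fin (d + 1) → ℤ) → MKer (d + 1) (Fib d)),
      (∃ B : ℝ, ∀ κ u κ' u' x z a b, |X κ u κ' u' x z a b| ≤ B) → (∃ B : ℝ, ∀ κ u κ' u' x z a b, |Y κ u κ' u' x z a b| ≤ B) →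
        lin4 (cE₂ * (Lc : ℝ) ^ (2 * (d + 1)))
              (unitK (sfStep Lc j) (smStep d Lc j) (G j)) Lc (X + Y) = lin4 (cE₂ * (Lc : ℝ) ^ (2 * (d + 1)))
              (unitK (sfStep Lc j) (smStep d Lc j) (G j)) Lc X + lin4 (cE₂ * (Lc : ℝ) ^ (2 * (d + 1)))
              (unitK (sfStep Lc j) (smStep d Lc j) (G j)) Lc Y := fun j X Y hX hY => by
    obtain ⟨C, δ, C₀, C₁, hδ, hK, -, -⟩ := hdat j
    exact lin4_add_of_bdd₄ hK hδ _ Lc hX hY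
  have hb : ∀ j, ∃ B : ℝ, ∀ κ u κ' u' x z a b, |(fun κ u κ' u' => (cE₂ * (Lc : ℝ) ^ (2 * (d + 1))) • mmRead Lc (K3OfK
        (unitK (sfStep Lc j) (smStep d Lc j) (G j)) Lc (unitS (sfStep Lc j) (smStep d Lc j) (S j))
        (unitM (sfStep Lc j) (smStep d Lc j) (M j)) (W2SymOfK (unitK (sfStep Lc j) (smStep d Lc j) (G j)) Lc
        (unitS (sfStep Lc j) (smStep d Lc j) (S j)) (unitM (sfStep Lc j) (smStep d Lc j) (M j)) 0
        (unitM₂ (sfStep Lc j) (smStep d Lc j) (M2Of d Lc mixFF j))) κ u κ' u') + cB • vh₂S κ u κ' u') κ u κ' u' x z a b| ≤ B := fun j => by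
    have e : (fun κ u κ' u' => (cE₂ * (Lc : ℝ) ^ (2 * (d + 1))) • mmRead Lc (K3OfK (unitK (sfStep Lc j) (smStep d Lc j) (G j)) Lc
          (unitS (sfStep Lc j) (smStep d Lc j) (S j)) (unitM (sfStep Lc j) (smStep d Lc j) (M j)) (W2SymOfK
          (unitK (sfStep Lc j) (smStep d Lc j) (G j)) Lc (unitS (sfStep Lc j) (smStep d Lc j) (S j))
          (unitM (sfStep Lc j) (smStep d Lc j) (M j)) 0
          (unitM₂ (sfStep Lc j) (smStep d Lc j) (M2Of d Lc mixFF j))) κ u κ' u') + cB • vh₂S κ u κ' u') =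
          (unitS₂ (sfStep Lc (j + 1)) (smStep d Lc (j + 1))
          (T2RecOf d Lc G S M cE₂ cB Tc vh₂S mixFF (j + 1))) - lin4 (cE₂ * (Lc : ℝ) ^ (2 * (d + 1)))
          (unitK (sfStep Lc j) (smStep d Lc j) (G j)) Lc (unitS₂ (sfStep Lc j) (smStep d Lc j)
          (T2RecOf d Lc G S M cE₂ cB Tc vh₂S mixFF j)) := by rw [hrec j, add_sub_cancel_left]
    rw [e]
    exact bdd₄_sub (hbdd (j + 1)) (hAP j _ (hbdd j))
  exact eq_transport_add_sum (A := fun j => lin4 (cE₂ * (Lc : ℝ) ^ (2 * (d + 1))) (unitK (sfStep Lc j) (smStep d Lc j) (G j)) Lc)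
    (P := fun X => ∃ B : ℝ, ∀ κ u κ' u' x z a b, |X κ u κ' u' x z a b| ≤ B)
    (x := fun j => (unitS₂ (sfStep Lc j) (smStep d Lc j) (T2RecOf d Lc G S M cE₂ cB Tc vh₂S mixFF j))) (b := fun j =>
          (fun κ u κ' u' => (cE₂ * (Lc : ℝ) ^ (2 * (d + 1))) • mmRead Lc (K3OfK (unitK (sfStep Lc j) (smStep d Lc j) (G j)) Lc
          (unitS (sfStep Lc j) (smStep d Lc j) (S j)) (unitM (sfStep Lc j) (smStep d Lc j) (M j)) (W2SymOfK
          (unitK (sfStep Lc j) (smStep d Lc j) (G j)) Lc (unitS (sfStep Lc j) (smStep d Lc j) (S j))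
          (unitM (sfStep Lc j) (smStep d Lc j) (M j)) 0
          (unitM₂ (sfStep Lc j) (smStep d Lc j) (M2Of d Lc mixFF j))) κ u κ' u') + cB • vh₂S κ u κ' u')) bdd₄_zero (fun _ _ => bdd₄_add) hAP
          hAadd (hbdd 0) hb hrec n

/-- [folklore] **(F1) FOR THE DIFFERENCE TOWER, SLOTTED family** (`hsplit` of the row owner's END #2 `WSlotT2OfPieces.rate_of_rows` with the SHIFTED transport
`P m k := transport (fun j ↦ lin4 c₄ G̃_j Lc) (m+1) k` and the forcing `f i := (𝒜_{i+1} − 𝒜_i)[T̃_i] + (b̃_{i+1} − b̃_i)`): for every `n`,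
`T̃_{n+1} − T̃_n = 𝒯 1 n (T̃_1 − T̃_0) + Σ_{i ∈ range n} 𝒯 (i+2) (n−1−i) f_i`.  Same hypotheses; leaf-01's `AffineUnroll.diff_eq_transport_add_sum` (twin of
`T2UnitSplitLevels.unitS₂_T2Of_sub_eq_transport_add_sum`). -/
theorem unitS₂_T2RecOf_sub_eq_transport_add_sum
    (hBff : ∀ κ u κ' u' x z (α β : Fin (d + 1)), vh₂S κ u κ' u' x z (Sum.inl α) (Sum.inl β) = 0)
    (hBmm : ∀ κ u κ' u' x z (μ ν : Fin (d + 1)), vh₂S κ u κ' u' x z (Sum.inr μ) (Sum.inr ν) = 0)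
    (hdat : ∀ j, ∃ C δ C₀ C₁ : ℝ, 0 < δ ∧ Decays (unitK (sfStep Lc j) (smStep d Lc j) (G j)) C δ ∧ VertexFamily₂ (W2SymOfK
          (unitK (sfStep Lc j) (smStep d Lc j) (G j)) Lc (unitS (sfStep Lc j) (smStep d Lc j) (S j))
          (unitM (sfStep Lc j) (smStep d Lc j) (M j)) 0 (unitM₂ (sfStep Lc j) (smStep d Lc j) (M2Of d Lc mixFF j))) Lc C₀ δ ∧
      VertexFamily₂ (W2SymOfK (unitK (sfStep Lc j) (smStep d Lc j) (G j)) Lc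
            (unitS (sfStep Lc j) (smStep d Lc j) (S j)) (unitM (sfStep Lc j) (smStep d Lc j) (M j))
            (unitS₂ (sfStep Lc j) (smStep d Lc j) (T2RecOf d Lc G S M cE₂ cB Tc vh₂S mixFF j))
            (unitM₂ (sfStep Lc j) (smStep d Lc j) (M2Of d Lc mixFF j))) Lc C₁ δ)
    (hbdd : ∀ j, ∃ B : ℝ, ∀ κ u κ' u' x z a b, |(unitS₂ (sfStep Lc j) (smStep d Lc j)
          (T2RecOf d Lc G S M cE₂ cB Tc vh₂S mixFF j)) κ u κ' u' x z a b| ≤ B) (n : ℕ) :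
    (fun κ u κ' u' => (unitS₂ (sfStep Lc (n + 1)) (smStep d Lc (n + 1)) (T2RecOf d Lc G S M cE₂ cB Tc vh₂S mixFF (n + 1))) κ u κ' u' -
          (unitS₂ (sfStep Lc n) (smStep d Lc n) (T2RecOf d Lc G S M cE₂ cB Tc vh₂S mixFF n)) κ u κ' u') =
      transport (fun j => lin4 (cE₂ * (Lc : ℝ) ^ (2 * (d + 1))) (unitK (sfStep Lc j) (smStep d Lc j) (G j)) Lc) 1 n
            (fun κ u κ' u' => (unitS₂ (sfStep Lc 1) (smStep d Lc 1) (T2RecOf d Lc G S M cE₂ cB Tc vh₂S mixFF 1)) κ u κ' u' -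
            (unitS₂ (sfStep Lc 0) (smStep d Lc 0) (T2RecOf d Lc G S M cE₂ cB Tc vh₂S mixFF 0)) κ u κ' u') +
        ∑ i ∈ Finset.range n, transport (fun j => lin4 (cE₂ * (Lc : ℝ) ^ (2 * (d + 1)))
              (unitK (sfStep Lc j) (smStep d Lc j) (G j)) Lc) (i + 2) (n - 1 - i)
          ((lin4 (cE₂ * (Lc : ℝ) ^ (2 * (d + 1))) (unitK (sfStep Lc (i + 1)) (smStep d Lc (i + 1)) (G (i + 1))) Lc
                (unitS₂ (sfStep Lc i) (smStep d Lc i) (T2RecOf d Lc G S M cE₂ cB Tc vh₂S mixFF i)) - lin4 (cE₂ * (Lc : ℝ) ^ (2 * (d + 1)))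
                (unitK (sfStep Lc i) (smStep d Lc i) (G i)) Lc (unitS₂ (sfStep Lc i) (smStep d Lc i)
                (T2RecOf d Lc G S M cE₂ cB Tc vh₂S mixFF i))) + ((fun κ u κ' u' => (cE₂ * (Lc : ℝ) ^ (2 * (d + 1))) • mmRead Lc (K3OfK
                (unitK (sfStep Lc (i + 1)) (smStep d Lc (i + 1)) (G (i + 1))) Lc
                (unitS (sfStep Lc (i + 1)) (smStep d Lc (i + 1)) (S (i + 1)))
                (unitM (sfStep Lc (i + 1)) (smStep d Lc (i + 1)) (M (i + 1))) (W2SymOfK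
                (unitK (sfStep Lc (i + 1)) (smStep d Lc (i + 1)) (G (i + 1))) Lc
                (unitS (sfStep Lc (i + 1)) (smStep d Lc (i + 1)) (S (i + 1)))
                (unitM (sfStep Lc (i + 1)) (smStep d Lc (i + 1)) (M (i + 1))) 0
                (unitM₂ (sfStep Lc (i + 1)) (smStep d Lc (i + 1)) (M2Of d Lc mixFF (i + 1)))) κ u κ' u') + cB • vh₂S κ u κ' u') -
                (fun κ u κ' u' => (cE₂ * (Lc : ℝ) ^ (2 * (d + 1))) • mmRead Lc (K3OfK
                (unitK (sfStep Lc i) (smStep d Lc i) (G i)) Lc (unitS (sfStep Lc i) (smStep d Lc i) (S i))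
                (unitM (sfStep Lc i) (smStep d Lc i) (M i)) (W2SymOfK (unitK (sfStep Lc i) (smStep d Lc i) (G i)) Lc
                (unitS (sfStep Lc i) (smStep d Lc i) (S i)) (unitM (sfStep Lc i) (smStep d Lc i) (M i)) 0
                (unitM₂ (sfStep Lc i) (smStep d Lc i) (M2Of d Lc mixFF i))) κ u κ' u') + cB • vh₂S κ u κ' u'))) := by
  have hrec : ∀ j, (unitS₂ (sfStep Lc (j + 1)) (smStep d Lc (j + 1))
        (T2RecOf d Lc G S M cE₂ cB Tc vh₂S mixFF (j + 1))) = lin4 (cE₂ * (Lc : ℝ) ^ (2 * (d + 1)))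
        (unitK (sfStep Lc j) (smStep d Lc j) (G j)) Lc (unitS₂ (sfStep Lc j) (smStep d Lc j)
        (T2RecOf d Lc G S M cE₂ cB Tc vh₂S mixFF j)) + (fun κ u κ' u' => (cE₂ * (Lc : ℝ) ^ (2 * (d + 1))) • mmRead Lc (K3OfK
        (unitK (sfStep Lc j) (smStep d Lc j) (G j)) Lc (unitS (sfStep Lc j) (smStep d Lc j) (S j))
        (unitM (sfStep Lc j) (smStep d Lc j) (M j)) (W2SymOfK (unitK (sfStep Lc j) (smStep d Lc j) (G j)) Lc
        (unitS (sfStep Lc j) (smStep d Lc j) (S j)) (unitM (sfStep Lc j) (smStep d Lc j) (M j)) 0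
        (unitM₂ (sfStep Lc j) (smStep d Lc j) (M2Of d Lc mixFF j))) κ u κ' u') + cB • vh₂S κ u κ' u') := fun j => by
    obtain ⟨C, δ, C₀, C₁, hδ, hK, h₀, hW⟩ := hdat j
    exact unitS₂_T2RecOf_succ_eq_lin4_add G S M cE₂ cB Tc vh₂S mixFF hBff hBmm j hδ hK h₀ hW
  have hAP : ∀ (j : ℕ) (X : Fin (d + 1) → (Fin (d + 1) → ℤ) → Fin (d + 1) → (Fin (d + 1) → ℤ) → MKer (d + 1) (Fib d)),
      (∃ B : ℝ, ∀ κ u κ' u' x z a b, |X κ u κ' u' x z a b| ≤ B) →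
        ∃ B : ℝ, ∀ κ u κ' u' x z a b, |lin4 (cE₂ * (Lc : ℝ) ^ (2 * (d + 1)))
              (unitK (sfStep Lc j) (smStep d Lc j) (G j)) Lc X κ u κ' u' x z a b| ≤ B := fun j X hX => by
    obtain ⟨C, δ, C₀, C₁, hδ, hK, -, -⟩ := hdat j
    exact lin4_bdd hK hδ _ Lc hX
  have hAadd : ∀ (j : ℕ) (X Y : Fin (d + 1) → (Fin (d + 1) → ℤ) → Fin (d + 1) → (Fin (d + 1) → ℤ) → MKer (d + 1) (Fib d)),
      (∃ B : ℝ, ∀ κ u κ' u' x z a b, |X κ u κ' u' x z a b| ≤ B) → (∃ B : ℝ, ∀ κ u κ' u' x z a b, |Y κ u κ' u' x z a b| ≤ B) →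
        lin4 (cE₂ * (Lc : ℝ) ^ (2 * (d + 1)))
              (unitK (sfStep Lc j) (smStep d Lc j) (G j)) Lc (X + Y) = lin4 (cE₂ * (Lc : ℝ) ^ (2 * (d + 1)))
              (unitK (sfStep Lc j) (smStep d Lc j) (G j)) Lc X + lin4 (cE₂ * (Lc : ℝ) ^ (2 * (d + 1)))
              (unitK (sfStep Lc j) (smStep d Lc j) (G j)) Lc Y := fun j X Y hX hY => by
    obtain ⟨C, δ, C₀, C₁, hδ, hK, -, -⟩ := hdat j
    exact lin4_add_of_bdd₄ hK hδ _ Lc hX hY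
  have hb : ∀ j, ∃ B : ℝ, ∀ κ u κ' u' x z a b, |(fun κ u κ' u' => (cE₂ * (Lc : ℝ) ^ (2 * (d + 1))) • mmRead Lc (K3OfK
        (unitK (sfStep Lc j) (smStep d Lc j) (G j)) Lc (unitS (sfStep Lc j) (smStep d Lc j) (S j))
        (unitM (sfStep Lc j) (smStep d Lc j) (M j)) (W2SymOfK (unitK (sfStep Lc j) (smStep d Lc j) (G j)) Lc
        (unitS (sfStep Lc j) (smStep d Lc j) (S j)) (unitM (sfStep Lc j) (smStep d Lc j) (M j)) 0
        (unitM₂ (sfStep Lc j) (smStep d Lc j) (M2Of d Lc mixFF j))) κ u κ' u') + cB • vh₂S κ u κ' u') κ u κ' u' x z a b| ≤ B := fun j => by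
    have e : (fun κ u κ' u' => (cE₂ * (Lc : ℝ) ^ (2 * (d + 1))) • mmRead Lc (K3OfK (unitK (sfStep Lc j) (smStep d Lc j) (G j)) Lc
          (unitS (sfStep Lc j) (smStep d Lc j) (S j)) (unitM (sfStep Lc j) (smStep d Lc j) (M j)) (W2SymOfK
          (unitK (sfStep Lc j) (smStep d Lc j) (G j)) Lc (unitS (sfStep Lc j) (smStep d Lc j) (S j))
          (unitM (sfStep Lc j) (smStep d Lc j) (M j)) 0
          (unitM₂ (sfStep Lc j) (smStep d Lc j) (M2Of d Lc mixFF j))) κ u κ' u') + cB • vh₂S κ u κ' u') =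
          (unitS₂ (sfStep Lc (j + 1)) (smStep d Lc (j + 1))
          (T2RecOf d Lc G S M cE₂ cB Tc vh₂S mixFF (j + 1))) - lin4 (cE₂ * (Lc : ℝ) ^ (2 * (d + 1)))
          (unitK (sfStep Lc j) (smStep d Lc j) (G j)) Lc (unitS₂ (sfStep Lc j) (smStep d Lc j)
          (T2RecOf d Lc G S M cE₂ cB Tc vh₂S mixFF j)) := by rw [hrec j, add_sub_cancel_left]
    rw [e]
    exact bdd₄_sub (hbdd (j + 1)) (hAP j _ (hbdd j))
  have h := diff_eq_transport_add_sum (A := fun j => lin4 (cE₂ * (Lc : ℝ) ^ (2 * (d + 1)))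
        (unitK (sfStep Lc j) (smStep d Lc j) (G j)) Lc)
    (P := fun X => ∃ B : ℝ, ∀ κ u κ' u' x z a b, |X κ u κ' u' x z a b| ≤ B)
    (x := fun j => (unitS₂ (sfStep Lc j) (smStep d Lc j) (T2RecOf d Lc G S M cE₂ cB Tc vh₂S mixFF j))) (b := fun j =>
          (fun κ u κ' u' => (cE₂ * (Lc : ℝ) ^ (2 * (d + 1))) • mmRead Lc (K3OfK (unitK (sfStep Lc j) (smStep d Lc j) (G j)) Lc
          (unitS (sfStep Lc j) (smStep d Lc j) (S j)) (unitM (sfStep Lc j) (smStep d Lc j) (M j)) (W2SymOfK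
          (unitK (sfStep Lc j) (smStep d Lc j) (G j)) Lc (unitS (sfStep Lc j) (smStep d Lc j) (S j))
          (unitM (sfStep Lc j) (smStep d Lc j) (M j)) 0
          (unitM₂ (sfStep Lc j) (smStep d Lc j) (M2Of d Lc mixFF j))) κ u κ' u') + cB • vh₂S κ u κ' u')) bdd₄_zero (fun _ _ => bdd₄_add) (fun
          _ _ => bdd₄_sub) hAP hAadd (hbdd 0) hb hrec n
  have e1 : (fun κ u κ' u' => (unitS₂ (sfStep Lc (n + 1)) (smStep d Lc (n + 1)) (T2RecOf d Lc G S M cE₂ cB Tc vh₂S mixFF (n + 1))) κ u κ' u' -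
        (unitS₂ (sfStep Lc n) (smStep d Lc n) (T2RecOf d Lc G S M cE₂ cB Tc vh₂S mixFF n)) κ u κ' u') =
        (unitS₂ (sfStep Lc (n + 1)) (smStep d Lc (n + 1)) (T2RecOf d Lc G S M cE₂ cB Tc vh₂S mixFF (n + 1))) - (unitS₂ (sfStep Lc n) (smStep d Lc n)
        (T2RecOf d Lc G S M cE₂ cB Tc vh₂S mixFF n)) := rfl
  have e0 : (fun κ u κ' u' => (unitS₂ (sfStep Lc 1) (smStep d Lc 1) (T2RecOf d Lc G S M cE₂ cB Tc vh₂S mixFF 1)) κ u κ' u' -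
        (unitS₂ (sfStep Lc 0) (smStep d Lc 0) (T2RecOf d Lc G S M cE₂ cB Tc vh₂S mixFF 0)) κ u κ' u') = (unitS₂ (sfStep Lc 1) (smStep d Lc 1)
        (T2RecOf d Lc G S M cE₂ cB Tc vh₂S mixFF 1)) - (unitS₂ (sfStep Lc 0) (smStep d Lc 0) (T2RecOf d Lc G S M cE₂ cB Tc vh₂S mixFF 0)) := rfl
  rw [e1, e0]
  exact h

end Generic

/-! ## §3 The per-level data from the slot letters (DG)(LS)(LM) + `hB` + `hmix` — (F1) MODULO THE LETTERS -/

section Letters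

variable {Lc : ℕ} [NeZero Lc] (G : ℕ → MKer (d + 1) (Fib d)) (S M : ℕ → Fin (d + 1) → (Fin (d + 1) → ℤ) → MKer (d + 1) (Fib d)) (cE₂ cB : ℝ)
  (Tc : Fin 4 → Fin 4 → Fin 4 → Fin 4 → ℝ)
  {vh₂S mixFF : Fin (d + 1) → (Fin (d + 1) → ℤ) → Fin (d + 1) → (Fin (d + 1) → ℤ) → MKer (d + 1) (Fib d)}

/-- [folklore] **THE STEP DATA FROM an2's SLOT LETTERS, at a common rate per level**: under `RecursiveWSlot`'s displayed letters (DG) `hG`, (LS) `hS`, (LM) `hM`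
and the binder letters `hB` ∕ `hmix`, for every `j` there are constants and ONE rate `δ > 0` with `Decays G̃_j C δ` (`decays_unitK`), and the `VertexFamily₂` shape at
rate `δ` of the normalised second-order member `W2SymOfK G̃_j Lc S̃_j M̃_j T̃_j M̃₂_j` (`= unitW_j (WrecOf … j)`: an2's `RecursiveWSlot.vertexFamily₂_WrecOf'` + an4's
`vertexFamily₂_unitW` ∕ `unitW_W2SymOfK`) and of its `T̃`-free part (an1's `vertexFamily₂_W2SymOfK'` on the ZERO bi-table) — EXISTENTIAL per `j`, no uniformity
(twin of leaf-01's `T2UnitSplitShapes.step_data_of_shapes`). -/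
theorem step_data_of_letters (hLc : 1 ≤ Lc) (hG : ∀ j : ℕ, ∃ δ C : ℝ, 0 < δ ∧ 0 ≤ C ∧ Decays (G j) C δ)
    (hS : ∀ j : ℕ, ∃ Cs δ : ℝ, 0 < δ ∧ LocStencil (S j) Cs δ) (hM : ∀ j : ℕ, ∃ CM δ : ℝ, 0 < δ ∧ VertexFamily (M j) Lc CM δ)
    (hB : ∃ C δ : ℝ, 0 < δ ∧ LocStencil₂ vh₂S C δ) (hmix : ∃ C δ : ℝ, 0 < δ ∧ LocStencilFM Lc mixFF C δ) (j : ℕ) :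
    ∃ C δ C₀ C₁ : ℝ, 0 < δ ∧ Decays (unitK (sfStep Lc j) (smStep d Lc j) (G j)) C δ ∧
      VertexFamily₂ (W2SymOfK (unitK (sfStep Lc j) (smStep d Lc j) (G j)) Lc
        (unitS (sfStep Lc j) (smStep d Lc j) (S j)) (unitM (sfStep Lc j) (smStep d Lc j) (M j)) 0
        (unitM₂ (sfStep Lc j) (smStep d Lc j) (M2Of d Lc mixFF j))) Lc C₀ δ ∧
      VertexFamily₂ (W2SymOfK (unitK (sfStep Lc j) (smStep d Lc j) (G j)) Lc
        (unitS (sfStep Lc j) (smStep d Lc j) (S j)) (unitM (sfStep Lc j) (smStep d Lc j) (M j))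
        (unitS₂ (sfStep Lc j) (smStep d Lc j) (T2RecOf d Lc G S M cE₂ cB Tc vh₂S mixFF j))
        (unitM₂ (sfStep Lc j) (smStep d Lc j) (M2Of d Lc mixFF j))) Lc C₁ δ := by
  -- the kernel
  obtain ⟨δK, CK, hδK, -, hK⟩ := hG j
  have hKu := decays_unitK (sf := sfStep Lc j) (sm := smStep d Lc j) hK
  -- the full second-order member
  obtain ⟨Cw, δw, hδw, hWb⟩ := vertexFamily₂_WrecOf' cE₂ cB Tc vh₂S mixFF hLc hG hS hM hB hmix j
  have hW := vertexFamily₂_unitW (sf := sfStep Lc j) (sm := smStep d Lc j) hWb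
  rw [WrecOf_eq, unitW_W2SymOfK (sfStep_ne_zero j) (smStep_ne_zero (d := d) j)] at hW
  -- its `T̃`-free part: an1's carrier on the ZERO bi-table
  obtain ⟨Cs, δs, hδs, hSl⟩ := hS j
  obtain ⟨CM, δM, hδM, hMl⟩ := hM j
  obtain ⟨CM₂, δ₃, hδ₃, hM₂⟩ := hmix
  have hZ : LocStencil₂ (0 : Fin (d + 1) → (Fin (d + 1) → ℤ) → Fin (d + 1) → (Fin (d + 1) → ℤ) → MKer (d + 1) (Fib d)) 0 1 :=
    fun κ u κ' u' x y a b => by simp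
  obtain ⟨Cw₀, δw₀, hδw₀, hW₀b⟩ := vertexFamily₂_W2SymOfK' (N := Lc) (hG j) hSl hδs hMl hδM hZ one_pos (locStencilFM_M2Of hM₂ j) hδ₃
  have hW₀ := vertexFamily₂_unitW (sf := sfStep Lc j) (sm := smStep d Lc j) hW₀b
  have e0 : unitS₂ (sfStep Lc j) (smStep d Lc j)
      (0 : Fin (d + 1) → (Fin (d + 1) → ℤ) → Fin (d + 1) → (Fin (d + 1) → ℤ) → MKer (d + 1) (Fib d)) = 0 := by
    funext κ u κ' u' x z a b
    rw [unitS₂_apply]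
    simp
  rw [unitW_W2SymOfK (sfStep_ne_zero j) (smStep_ne_zero (d := d) j), e0] at hW₀
  -- merge the three rates
  have hCK : 0 ≤ max |sfStep Lc j| |smStep d Lc j| * CK * max |sfStep Lc j| |smStep d Lc j| := hKu.nonneg (Sum.inl 0)
  have hC₁ : 0 ≤ max |(sfStep Lc j)⁻¹| |(smStep d Lc j)⁻¹| * Cw * max |(sfStep Lc j)⁻¹| |(smStep d Lc j)⁻¹| :=
    (hW 0 0 0 0).nonneg (Sum.inl 0)
  have hC₀ : 0 ≤ max |(sfStep Lc j)⁻¹| |(smStep d Lc j)⁻¹| * Cw₀ * max |(sfStep Lc j)⁻¹| |(smStep d Lc j)⁻¹| :=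
    (hW₀ 0 0 0 0).nonneg (Sum.inl 0)
  exact ⟨_, min δK (min δw δw₀), _, _, lt_min hδK (lt_min hδw hδw₀), decays_mono hKu hCK le_rfl (min_le_left _ _),
    vertexFamily₂_mono hW₀ hC₀ ((min_le_right _ _).trans (min_le_right _ _)),
    vertexFamily₂_mono hW hC₁ ((min_le_right _ _).trans (min_le_left _ _))⟩

/-- [folklore] **BOUNDED ENTRIES OF EVERY NORMALISED MEMBER FROM THE LETTERS** (an2's `RecursiveWSlot.T2RecOf_loc` + leaf-01's `bdd₄_unitS₂` ∕ `bdd₄_of_locStencil₂`). -/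
theorem bdd₄_unitS₂_T2RecOf_of_letters (hLc : 1 ≤ Lc) (hG : ∀ j : ℕ, ∃ δ C : ℝ, 0 < δ ∧ 0 ≤ C ∧ Decays (G j) C δ)
    (hS : ∀ j : ℕ, ∃ Cs δ : ℝ, 0 < δ ∧ LocStencil (S j) Cs δ) (hM : ∀ j : ℕ, ∃ CM δ : ℝ, 0 < δ ∧ VertexFamily (M j) Lc CM δ)
    (hB : ∃ C δ : ℝ, 0 < δ ∧ LocStencil₂ vh₂S C δ) (hmix : ∃ C δ : ℝ, 0 < δ ∧ LocStencilFM Lc mixFF C δ) (j : ℕ) :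
    ∃ B : ℝ, ∀ κ u κ' u' x z a b,
      |unitS₂ (sfStep Lc j) (smStep d Lc j) (T2RecOf d Lc G S M cE₂ cB Tc vh₂S mixFF j) κ u κ' u' x z a b| ≤ B := by
  obtain ⟨C, δ, hδ, h⟩ := T2RecOf_loc cE₂ cB Tc vh₂S mixFF hLc hG hS hM hB hmix j
  exact bdd₄_unitS₂ _ _ (bdd₄_of_locStencil₂ h hδ.le)

/-- NOT IN PRINT; OUR BOOKKEEPING ([folklore] composition).  **(F1) FOR THE SLOTTED FAMILY MODULO an2's LETTERS ONLY**: the level sum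
`T̃_n = 𝒯 0 n T̃_0 + Σ_{i<n} 𝒯 (i+1) (n−1−i) b̃_i` of `unitS₂_T2RecOf_eq_transport_add_sum` with the per-level step data and the bounded entries DISCHARGED from
(DG)(LS)(LM) + `hB` + `hmix` (`step_data_of_letters`, `bdd₄_unitS₂_T2RecOf_of_letters`); (ShB₂) on `vh₂S` displayed.  For the comb family all five letters are TREE
(`decays_coDressKBmAt_KInvStep`, `locStencil_SpureRecAt`, `vertexFamily_M1At`, and an1's border ∕ mixed-table lemmas) — see `RecursiveWSlot.T2RecAt_loc_of_slot`. -/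
theorem unitS₂_T2RecOf_eq_transport_add_sum_of_letters (hLc : 1 ≤ Lc)
    (hBff : ∀ κ u κ' u' x z (α β : Fin (d + 1)), vh₂S κ u κ' u' x z (Sum.inl α) (Sum.inl β) = 0)
    (hBmm : ∀ κ u κ' u' x z (μ ν : Fin (d + 1)), vh₂S κ u κ' u' x z (Sum.inr μ) (Sum.inr ν) = 0)
    (hG : ∀ j : ℕ, ∃ δ C : ℝ, 0 < δ ∧ 0 ≤ C ∧ Decays (G j) C δ)
    (hS : ∀ j : ℕ, ∃ Cs δ : ℝ, 0 < δ ∧ LocStencil (S j) Cs δ) (hM : ∀ j : ℕ, ∃ CM δ : ℝ, 0 < δ ∧ VertexFamily (M j) Lc CM δ)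
    (hB : ∃ C δ : ℝ, 0 < δ ∧ LocStencil₂ vh₂S C δ) (hmix : ∃ C δ : ℝ, 0 < δ ∧ LocStencilFM Lc mixFF C δ) (n : ℕ) :
    (unitS₂ (sfStep Lc n) (smStep d Lc n) (T2RecOf d Lc G S M cE₂ cB Tc vh₂S mixFF n)) = transport (fun j => lin4 (cE₂ * (Lc : ℝ) ^ (2 * (d + 1)))
          (unitK (sfStep Lc j) (smStep d Lc j) (G j)) Lc) 0 n (unitS₂ (sfStep Lc 0) (smStep d Lc 0)
          (T2RecOf d Lc G S M cE₂ cB Tc vh₂S mixFF 0)) +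
      ∑ i ∈ Finset.range n, transport (fun j => lin4 (cE₂ * (Lc : ℝ) ^ (2 * (d + 1)))
            (unitK (sfStep Lc j) (smStep d Lc j) (G j)) Lc) (i + 1) (n - 1 - i)
            (fun κ u κ' u' => (cE₂ * (Lc : ℝ) ^ (2 * (d + 1))) • mmRead Lc (K3OfK (unitK (sfStep Lc i) (smStep d Lc i) (G i)) Lc
            (unitS (sfStep Lc i) (smStep d Lc i) (S i)) (unitM (sfStep Lc i) (smStep d Lc i) (M i)) (W2SymOfK
            (unitK (sfStep Lc i) (smStep d Lc i) (G i)) Lc (unitS (sfStep Lc i) (smStep d Lc i) (S i))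
            (unitM (sfStep Lc i) (smStep d Lc i) (M i)) 0
            (unitM₂ (sfStep Lc i) (smStep d Lc i) (M2Of d Lc mixFF i))) κ u κ' u') + cB • vh₂S κ u κ' u') :=
  unitS₂_T2RecOf_eq_transport_add_sum G S M cE₂ cB Tc vh₂S mixFF hBff hBmm (step_data_of_letters G S M cE₂ cB Tc hLc hG hS hM hB hmix)
    (bdd₄_unitS₂_T2RecOf_of_letters G S M cE₂ cB Tc hLc hG hS hM hB hmix) n

end Letters
end Summit.QuantumFields.BalabanUV.Beta.GAN24.T2RecOfUnitSplit

end
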